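import Summits.Ventures.Crystal3D.Theorems.StickyWulffConstantCoaxialWallLawTailResidueDefsM
import Summits.Ventures.Crystal3D.Theorems.StickyWulffConstantCoaxialWallLawEndRowTail
import HarnessLib

/-!
# The PAYER-POOL bound: the joint (A)-summand at a payer of degree `k ≤ 3` is `≤ 13k/(12−k) ≤ 13/3 < 2√6` — census-free,
# for every frame and every window (crux `CoaxialWallLaw`, stmt-Ventures-19481, line `WallLedgerF`, stub `stub_multiGrainSmall`)

HONEST FRAMING. Venture `Summits/Ventures/Crystal3D` (cell `crystal3d-full`), helper `--supports` the crux `CoaxialWallLaw` of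
`route-Ventures-StickyWulffConstant` (REGISTERED line `WallLedgerF`, skeleton 'CoaxialWallLawCertificates' v3, registered stub
`stub_multiGrainSmall : TailResidue.MultiGrainSmall (2√6)`).  Rung credit only; F-C1 not moved; census-free, no kissing facts beyond the
tree's kissing bound `card_filter_dist_eq_one_le_twelve`.
Regime (R-i) of F-TAIL-g10 §8 (cf-p1 (cxlix)/(clxxvi): «the dust-payer POOLED bound first»): a LOOSE payer `z` (dust rattling in a pocket)
touches few balls, and the payer itself is one unit-of-deficiency-`(12 − deg z)` member of the pool of EVERY ball it loads.  The bookkeeping,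
valid for EVERY `1`-separated window, EVERY frame and EVERY pair of plate systems with slot roots:
* `endMultA_le_degree` — `endMultA b ≤ deg b` (an (A)-end pair `(b, q)` is a contact: `…EndRowTail.dist_eq_one_of_isEndPair`);
* `twelve_sub_degree_le_pooledDef` — `dist b z ≤ 1`, `deg z ≤ 11` ⇒ `12 − deg z ≤ pooledDef X b`;
* **`localSummandA_le_sum_endMultA_div`** — `Σ_A(z) ≤ (Σ_{b ∈ X ∩ B̄(z,1)} endMultA b) / (12 − deg z)` (THE POOLED BOUND);
* `sum_endMultA_ball_le` — `Σ_{b ∈ X ∩ B̄(z,1)} endMultA b ≤ 13 · deg z` (`deg z` for `b = z`, `12` for each of the `deg z` contacts);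
* **`localSummandA_le_of_degree`** — `Σ_A(z) ≤ 13 · deg z / (12 − deg z)`;
* **`localSummandA_le_two_sqrt_six_of_degree_le_three`** — `deg z ≤ 3 ⇒ Σ_A(z) ≤ 2√6` (`13/3 < 2√6`), and the `MultiGrainSmall`-shaped
  corollary **`TailResidue.multiGrainSmall_of_degree_le_three`**: the registered stub's conclusion at every payer of degree `≤ 3`, with NO
  off-site / mono-module hypothesis.
* `pooledDef_ge_of_readers_deficient`, **`localSummandA_le_of_readers_deficient`** — if every (A)-predecessor of every loaded contact of `z` is
  DEFICIENT (each is then one more pool member): `Σ_A(z) ≤ k/(12−k) + 12k/(23−k)`; **`localSummandA_le_two_sqrt_six_of_degree_le_five`**,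
  `TailResidue.multiGrainSmall_of_degree_le_five_of_readers_deficient` — `deg z ≤ 5` and no FULL reader ⇒ `≤ 5/7 + 10/3 < 2√6`.
Degrees `≥ 6`, and payers whose contacts are read by FULLY COORDINATED balls (a perfect crystallite next to the dust), are the content of
(R-i′)/(R-ii)/(R-iii) (geometry of the readers' pools), not of this file.
WHAT THIS IS NOT: not `MultiGrainSmall`; F-C1 not moved.
-/

noncomputable section

namespace Summit.Ventures.Crystal3D.Theorems

open Summit.Ventures.Crystal3D Finset
open scoped InnerProductSpace

section PayerPool

variable {X : Finset (EuclideanSpace ℝ (Fin 3))} (v : WordVersion) {S₁ S₂ : PlateSystem}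

open scoped Classical in
/-- **(A)-end multiplicity is at most the degree**: every predecessor `q` of an (A)-end pair `(b, q)` is a contact of `b`. -/
theorem endMultA_le_degree (h₁ : S₁.RT ⊆ fccSlots) (h₂ : S₂.RT ⊆ fccSlots) (b : EuclideanSpace ℝ (Fin 3)) :
    endMultA X v S₁ S₂ b ≤ (X.filter fun q => dist b q = 1).card := by
  unfold endMultA
  exact card_le_card fun q hq => by
    rw [mem_filter] at hq ⊢
    exact ⟨hq.1, dist_eq_one_of_isEndPair h₁ h₂ (isEndPair_of_isEndPairA hq.2)⟩

open scoped Classical in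
/-- **The payer is a member of the pool of every ball it loads**: `dist b z ≤ 1`, `deg z ≤ 11` ⇒ `12 − deg z ≤ pooledDef X b`. -/
theorem twelve_sub_degree_le_pooledDef {z b : EuclideanSpace ℝ (Fin 3)} (hz : z ∈ X) (hbz : dist b z ≤ 1)
    (hdeg : (X.filter fun q => dist z q = 1).card ≤ 11) :
    (12 : ℝ) - ((X.filter fun q => dist z q = 1).card : ℝ) ≤ pooledDef X b := by
  unfold pooledDef
  refine single_le_sum (f := fun z' => (12 : ℝ) - ((X.filter fun q => dist z' q = 1).card : ℝ)) (fun z' hz' => ?_)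
    (mem_filter.2 ⟨hz, hbz, hdeg⟩)
  have : ((X.filter fun q => dist z' q = 1).card : ℝ) ≤ 11 := by exact_mod_cast (mem_filter.1 hz').2.2
  linarith

open scoped Classical in
/-- **THE POOLED BOUND AT A PAYER.**  At a payer `z` of degree `deg z ≤ 11`:
`Σ_A(z) ≤ (Σ_{b ∈ X, dist z b ≤ 1} endMultA b) / (12 − deg z)`. -/
theorem localSummandA_le_sum_endMultA_div {z : EuclideanSpace ℝ (Fin 3)} (hz : z ∈ X)
    (hdeg : (X.filter fun q => dist z q = 1).card ≤ 11) :
    localSummandA v S₁ S₂ X z ≤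
      (∑ b ∈ X.filter (fun b => dist z b ≤ 1), (endMultA X v S₁ S₂ b : ℝ)) /
        ((12 : ℝ) - ((X.filter fun q => dist z q = 1).card : ℝ)) := by
  have hk : (0 : ℝ) < (12 : ℝ) - ((X.filter fun q => dist z q = 1).card : ℝ) := by
    have : ((X.filter fun q => dist z q = 1).card : ℝ) ≤ 11 := by exact_mod_cast hdeg
    linarith
  unfold localSummandA
  rw [sum_div]
  calc ∑ b ∈ X.filter (fun b => dist z b ≤ 1 ∧ 0 < endMultA X v S₁ S₂ b), (endMultA X v S₁ S₂ b : ℝ) / pooledDef X b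
      ≤ ∑ b ∈ X.filter (fun b => dist z b ≤ 1 ∧ 0 < endMultA X v S₁ S₂ b),
          (endMultA X v S₁ S₂ b : ℝ) / ((12 : ℝ) - ((X.filter fun q => dist z q = 1).card : ℝ)) := by
        refine sum_le_sum fun b hb => ?_
        obtain ⟨-, hzb, -⟩ := mem_filter.1 hb
        exact div_le_div_of_nonneg_left (Nat.cast_nonneg _) hk
          (twelve_sub_degree_le_pooledDef (X := X) hz (by rw [dist_comm]; exact hzb) hdeg)
    _ ≤ ∑ b ∈ X.filter (fun b => dist z b ≤ 1),
          (endMultA X v S₁ S₂ b : ℝ) / ((12 : ℝ) - ((X.filter fun q => dist z q = 1).card : ℝ)) := by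
        refine sum_le_sum_of_subset_of_nonneg (fun b hb => ?_) fun b _ _ => div_nonneg (Nat.cast_nonneg _) hk.le
        rw [mem_filter] at hb ⊢
        exact ⟨hb.1, hb.2.1⟩

open scoped Classical in
/-- **The numerator**: `Σ_{b ∈ X, dist z b ≤ 1} endMultA b ≤ 13 · deg z` — the payer contributes `endMultA z ≤ deg z`, and each of its
`deg z` contacts contributes `≤ 12` (kissing bound). -/
theorem sum_endMultA_ball_le (hX : ∀ p ∈ X, ∀ q ∈ X, p ≠ q → 1 ≤ dist p q) (h₁ : S₁.RT ⊆ fccSlots)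
    (h₂ : S₂.RT ⊆ fccSlots) {z : EuclideanSpace ℝ (Fin 3)} (hz : z ∈ X) :
    (∑ b ∈ X.filter (fun b => dist z b ≤ 1), (endMultA X v S₁ S₂ b : ℝ)) ≤
      13 * ((X.filter fun q => dist z q = 1).card : ℝ) := by
  -- split the closed unit ball of `z` into `{z}` and the contacts
  have hsplit : X.filter (fun b => dist z b ≤ 1) = insert z (X.filter fun q => dist z q = 1) := by
    ext b
    simp only [mem_filter, mem_insert]
    constructor
    · rintro ⟨hb, hzb⟩
      by_cases hbz : b = z
      · exact Or.inl hbz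
      · exact Or.inr ⟨hb, le_antisymm hzb (hX z hz b hb (Ne.symm hbz))⟩
    · rintro (rfl | ⟨hb, hzb⟩)
      · exact ⟨hz, by simp⟩
      · exact ⟨hb, hzb.le⟩
  have hznot : z ∉ X.filter (fun q => dist z q = 1) := by simp
  rw [hsplit, sum_insert hznot]
  have hzle : (endMultA X v S₁ S₂ z : ℝ) ≤ ((X.filter fun q => dist z q = 1).card : ℝ) := by
    exact_mod_cast endMultA_le_degree v h₁ h₂ z
  have hball : ∀ b ∈ X.filter (fun q => dist z q = 1), (endMultA X v S₁ S₂ b : ℝ) ≤ 12 := by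
    intro b hb
    have h := (endMultA_le_degree v h₁ h₂ b).trans (card_filter_dist_eq_one_le_twelve X hX b)
    exact_mod_cast h
  have hsum := sum_le_sum hball
  rw [sum_const, nsmul_eq_mul] at hsum
  linarith

open scoped Classical in
/-- **DEGREE BOUND FOR THE JOINT (A)-SUMMAND**: `Σ_A(z) ≤ 13 · deg z / (12 − deg z)` at every payer `z` with `deg z ≤ 11` — for every
`1`-separated window and every pair of plate systems with slot roots. -/
theorem localSummandA_le_of_degree (hX : ∀ p ∈ X, ∀ q ∈ X, p ≠ q → 1 ≤ dist p q) (h₁ : S₁.RT ⊆ fccSlots)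
    (h₂ : S₂.RT ⊆ fccSlots) {z : EuclideanSpace ℝ (Fin 3)} (hz : z ∈ X) (hdeg : (X.filter fun q => dist z q = 1).card ≤ 11) :
    localSummandA v S₁ S₂ X z ≤
      13 * ((X.filter fun q => dist z q = 1).card : ℝ) / ((12 : ℝ) - ((X.filter fun q => dist z q = 1).card : ℝ)) := by
  have hk : (0 : ℝ) < (12 : ℝ) - ((X.filter fun q => dist z q = 1).card : ℝ) := by
    have : ((X.filter fun q => dist z q = 1).card : ℝ) ≤ 11 := by exact_mod_cast hdeg
    linarith
  exact (localSummandA_le_sum_endMultA_div v hz hdeg).trans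
    (div_le_div_of_nonneg_right (sum_endMultA_ball_le v hX h₁ h₂ hz) hk.le)

open scoped Classical in
/-- **LOW-DEGREE PAYERS ARE UNDER THE LINE**: `deg z ≤ 3 ⇒ Σ_A(z) ≤ 2√6` (`13·3/9 = 13/3 < 2√6`). -/
theorem localSummandA_le_two_sqrt_six_of_degree_le_three (hX : ∀ p ∈ X, ∀ q ∈ X, p ≠ q → 1 ≤ dist p q)
    (h₁ : S₁.RT ⊆ fccSlots) (h₂ : S₂.RT ⊆ fccSlots) {z : EuclideanSpace ℝ (Fin 3)} (hz : z ∈ X)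
    (hdeg : (X.filter fun q => dist z q = 1).card ≤ 3) :
    localSummandA v S₁ S₂ X z ≤ 2 * Real.sqrt 6 := by
  have hk3 : ((X.filter fun q => dist z q = 1).card : ℝ) ≤ 3 := by exact_mod_cast hdeg
  have hk0 : (0 : ℝ) ≤ ((X.filter fun q => dist z q = 1).card : ℝ) := Nat.cast_nonneg _
  refine (localSummandA_le_of_degree v hX h₁ h₂ hz (hdeg.trans (by norm_num))).trans ?_
  rw [div_le_iff₀ (by linarith)]
  have h6 : Real.sqrt 6 * Real.sqrt 6 = 6 := Real.mul_self_sqrt (by norm_num)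
  have h24 : (12 : ℝ) / 5 ≤ Real.sqrt 6 := by
    rw [show (12 : ℝ) / 5 = Real.sqrt (((12 : ℝ) / 5) ^ 2) by rw [Real.sqrt_sq (by norm_num)]]
    exact Real.sqrt_le_sqrt (by norm_num)
  nlinarith

end PayerPool

section DeficientReaders

variable {X : Finset (EuclideanSpace ℝ (Fin 3))} (v : WordVersion) {S₁ S₂ : PlateSystem}

open scoped Classical in
/-- **Deficient readers load the pool.**  If every (A)-predecessor `q` of the loaded ball `b ≠ z` (`dist b z ≤ 1`) is deficient (`deg q ≤ 11`),
then `(11 − deg z) + endMultA b ≤ pooledDef X b`: the payer contributes `12 − deg z`, and each of the `endMultA b` predecessors (contacts of `b`,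
at most one of which is `z`) one further unit. -/
theorem pooledDef_ge_of_readers_deficient (h₁ : S₁.RT ⊆ fccSlots) (h₂ : S₂.RT ⊆ fccSlots) {z b : EuclideanSpace ℝ (Fin 3)}
    (hz : z ∈ X) (hbz : dist b z ≤ 1) (hdeg : (X.filter fun q => dist z q = 1).card ≤ 11)
    (hR : ∀ q ∈ X, IsEndPairA X v S₁ S₂ b q → (X.filter fun y => dist q y = 1).card ≤ 11) :
    (11 : ℝ) - ((X.filter fun q => dist z q = 1).card : ℝ) + (endMultA X v S₁ S₂ b : ℝ) ≤ pooledDef X b := by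
  set R := X.filter (fun q => IsEndPairA X v S₁ S₂ b q) with hRdef
  have hRcard : endMultA X v S₁ S₂ b = R.card := by unfold endMultA; rfl
  set f : EuclideanSpace ℝ (Fin 3) → ℝ := fun y => (12 : ℝ) - ((X.filter fun q => dist y q = 1).card : ℝ) with hf
  -- the pool contains `z` and every predecessor
  have hsub : insert z (R.erase z) ⊆ X.filter (fun y => dist b y ≤ 1 ∧ (X.filter fun q => dist y q = 1).card ≤ 11) := by
    intro y hy
    rcases mem_insert.1 hy with rfl | hy
    · exact mem_filter.2 ⟨hz, hbz, hdeg⟩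
    · have hyR : y ∈ R := mem_of_mem_erase hy
      obtain ⟨hyX, hpair⟩ := mem_filter.1 hyR
      refine mem_filter.2 ⟨hyX, ?_, hR y hyX hpair⟩
      exact (dist_eq_one_of_isEndPair h₁ h₂ (isEndPair_of_isEndPairA hpair)).le
  have hnonneg : ∀ y ∈ X.filter (fun y => dist b y ≤ 1 ∧ (X.filter fun q => dist y q = 1).card ≤ 11), 0 ≤ f y := by
    intro y hy
    have : ((X.filter fun q => dist y q = 1).card : ℝ) ≤ 11 := by exact_mod_cast (mem_filter.1 hy).2.2
    simp only [hf]; linarith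
  have hge1 : ∀ y ∈ R.erase z, (1 : ℝ) ≤ f y := by
    intro y hy
    obtain ⟨hyX, hpair⟩ := mem_filter.1 (mem_of_mem_erase hy)
    have : ((X.filter fun q => dist y q = 1).card : ℝ) ≤ 11 := by exact_mod_cast hR y hyX hpair
    simp only [hf]; linarith
  have hcard : (R.card : ℝ) ≤ ((R.erase z).card : ℝ) + 1 := by
    have := pred_card_le_card_erase (s := R) (a := z)
    exact_mod_cast (by omega : R.card ≤ (R.erase z).card + 1)
  have hsumR : (((R.erase z).card : ℕ) : ℝ) ≤ ∑ y ∈ R.erase z, f y := by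
    have h := sum_le_sum hge1
    rw [sum_const, nsmul_eq_mul, mul_one] at h
    exact h
  unfold pooledDef
  calc (11 : ℝ) - ((X.filter fun q => dist z q = 1).card : ℝ) + (endMultA X v S₁ S₂ b : ℝ)
      ≤ f z + ∑ y ∈ R.erase z, f y := by
        rw [hRcard]; simp only [hf]; linarith
    _ = ∑ y ∈ insert z (R.erase z), f y := (sum_insert (notMem_erase z R)).symm
    _ ≤ ∑ y ∈ X.filter (fun y => dist b y ≤ 1 ∧ (X.filter fun q => dist y q = 1).card ≤ 11), f y :=
        sum_le_sum_of_subset_of_nonneg hsub fun y hy _ => hnonneg y hy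

open scoped Classical in
/-- **THE DEFICIENT-READER BOUND.**  If at the payer `z` (degree `k ≤ 11`) every (A)-predecessor of every loaded contact `b ≠ z` of `z` is deficient,
then `Σ_A(z) ≤ k/(12−k) + 12k/(23−k)`. -/
theorem localSummandA_le_of_readers_deficient (hX : ∀ p ∈ X, ∀ q ∈ X, p ≠ q → 1 ≤ dist p q) (h₁ : S₁.RT ⊆ fccSlots)
    (h₂ : S₂.RT ⊆ fccSlots) {z : EuclideanSpace ℝ (Fin 3)} (hz : z ∈ X) (hdeg : (X.filter fun q => dist z q = 1).card ≤ 11)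
    (hR : ∀ b ∈ X, dist z b ≤ 1 → b ≠ z → ∀ q ∈ X, IsEndPairA X v S₁ S₂ b q → (X.filter fun y => dist q y = 1).card ≤ 11) :
    localSummandA v S₁ S₂ X z ≤
      ((X.filter fun q => dist z q = 1).card : ℝ) / ((12 : ℝ) - ((X.filter fun q => dist z q = 1).card : ℝ)) +
        ((X.filter fun q => dist z q = 1).card : ℝ) * (12 / ((23 : ℝ) - ((X.filter fun q => dist z q = 1).card : ℝ))) := by
  set k : ℝ := ((X.filter fun q => dist z q = 1).card : ℝ) with hk
  have hk11 : k ≤ 11 := by rw [hk]; exact_mod_cast hdeg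
  have hk0 : 0 ≤ k := by rw [hk]; exact Nat.cast_nonneg _
  have h12k : 0 < 12 - k := by linarith
  have h23k : 0 < 23 - k := by linarith
  set g : EuclideanSpace ℝ (Fin 3) → ℝ := fun b => (endMultA X v S₁ S₂ b : ℝ) / pooledDef X b with hg
  set F := X.filter (fun b => dist z b ≤ 1 ∧ 0 < endMultA X v S₁ S₂ b) with hF
  have hpnn : ∀ b, 0 ≤ pooledDef X b := fun b => by
    unfold pooledDef
    exact sum_nonneg fun y hy => by
      have : ((X.filter fun q => dist y q = 1).card : ℝ) ≤ 11 := by exact_mod_cast (mem_filter.1 hy).2.2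
      linarith
  have hgnn : ∀ b, 0 ≤ g b := fun b => div_nonneg (Nat.cast_nonneg _) (hpnn b)
  -- the payer's own term
  have hgz : g z ≤ k / (12 - k) := by
    have hp : 12 - k ≤ pooledDef X z := by
      rw [hk]; exact twelve_sub_degree_le_pooledDef (X := X) hz (by simp) hdeg
    have he : (endMultA X v S₁ S₂ z : ℝ) ≤ k := by rw [hk]; exact_mod_cast endMultA_le_degree v h₁ h₂ z
    calc g z = (endMultA X v S₁ S₂ z : ℝ) / pooledDef X z := rfl
      _ ≤ (endMultA X v S₁ S₂ z : ℝ) / (12 - k) := div_le_div_of_nonneg_left (Nat.cast_nonneg _) h12k hp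
      _ ≤ k / (12 - k) := div_le_div_of_nonneg_right he h12k.le
  -- the contacts' terms
  have hgb : ∀ b ∈ F.erase z, g b ≤ 12 / (23 - k) := by
    intro b hb
    obtain ⟨hbz, hbF⟩ := mem_erase.1 hb
    obtain ⟨hbX, hzb, hepos⟩ := mem_filter.1 hbF
    have he1 : (1 : ℝ) ≤ (endMultA X v S₁ S₂ b : ℝ) := by exact_mod_cast hepos
    have he12 : (endMultA X v S₁ S₂ b : ℝ) ≤ 12 := by
      exact_mod_cast (endMultA_le_degree v h₁ h₂ b).trans (card_filter_dist_eq_one_le_twelve X hX b)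
    have hp : 11 - k + (endMultA X v S₁ S₂ b : ℝ) ≤ pooledDef X b := by
      rw [hk]
      exact pooledDef_ge_of_readers_deficient v h₁ h₂ hz (by rw [dist_comm]; exact hzb) hdeg (hR b hbX hzb hbz)
    have hppos : 0 < 11 - k + (endMultA X v S₁ S₂ b : ℝ) := by linarith
    calc g b = (endMultA X v S₁ S₂ b : ℝ) / pooledDef X b := rfl
      _ ≤ (endMultA X v S₁ S₂ b : ℝ) / (11 - k + (endMultA X v S₁ S₂ b : ℝ)) :=
          div_le_div_of_nonneg_left (Nat.cast_nonneg _) hppos hp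
      _ ≤ 12 / (23 - k) := by
          rw [div_le_div_iff₀ hppos h23k]
          nlinarith
  -- at most `k` contacts
  have hFcard : ((F.erase z).card : ℝ) ≤ k := by
    rw [hk]
    exact_mod_cast card_le_card (fun b hb => by
      obtain ⟨hbz, hbF⟩ := mem_erase.1 hb
      obtain ⟨hbX, hzb, -⟩ := mem_filter.1 hbF
      exact mem_filter.2 ⟨hbX, le_antisymm hzb (hX z hz b hbX (Ne.symm hbz))⟩)
  have hsumF : ∑ b ∈ F.erase z, g b ≤ k * (12 / (23 - k)) := by
    have h := sum_le_sum hgb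
    rw [sum_const, nsmul_eq_mul] at h
    exact h.trans (mul_le_mul_of_nonneg_right hFcard (div_nonneg (by norm_num) h23k.le))
  unfold localSummandA
  calc ∑ b ∈ F, g b ≤ ∑ b ∈ insert z (F.erase z), g b :=
        sum_le_sum_of_subset_of_nonneg (insert_erase_subset z F) fun b _ _ => hgnn b
    _ = g z + ∑ b ∈ F.erase z, g b := sum_insert (notMem_erase z F)
    _ ≤ k / (12 - k) + k * (12 / (23 - k)) := add_le_add hgz hsumF

open scoped Classical in
/-- **PAYERS OF DEGREE `≤ 5` WITHOUT A FULL READER ARE UNDER THE LINE**: if `deg z ≤ 5` and every (A)-predecessor of every loaded contact of `z` is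
deficient, then `Σ_A(z) ≤ 5/7 + 10/3 < 2√6`. -/
theorem localSummandA_le_two_sqrt_six_of_degree_le_five (hX : ∀ p ∈ X, ∀ q ∈ X, p ≠ q → 1 ≤ dist p q) (h₁ : S₁.RT ⊆ fccSlots)
    (h₂ : S₂.RT ⊆ fccSlots) {z : EuclideanSpace ℝ (Fin 3)} (hz : z ∈ X) (hdeg : (X.filter fun q => dist z q = 1).card ≤ 5)
    (hR : ∀ b ∈ X, dist z b ≤ 1 → b ≠ z → ∀ q ∈ X, IsEndPairA X v S₁ S₂ b q → (X.filter fun y => dist q y = 1).card ≤ 11) :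
    localSummandA v S₁ S₂ X z ≤ 2 * Real.sqrt 6 := by
  have hk5 : ((X.filter fun q => dist z q = 1).card : ℝ) ≤ 5 := by exact_mod_cast hdeg
  have hk0 : (0 : ℝ) ≤ ((X.filter fun q => dist z q = 1).card : ℝ) := Nat.cast_nonneg _
  refine (localSummandA_le_of_readers_deficient v hX h₁ h₂ hz (hdeg.trans (by norm_num)) hR).trans ?_
  have h24 : (12 : ℝ) / 5 ≤ Real.sqrt 6 := by
    rw [show (12 : ℝ) / 5 = Real.sqrt (((12 : ℝ) / 5) ^ 2) by rw [Real.sqrt_sq (by norm_num)]]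
    exact Real.sqrt_le_sqrt (by norm_num)
  have hA : ((X.filter fun q => dist z q = 1).card : ℝ) / ((12 : ℝ) - ((X.filter fun q => dist z q = 1).card : ℝ)) ≤ 5 / 7 := by
    rw [div_le_div_iff₀ (by linarith) (by norm_num)]; linarith
  have hB : ((X.filter fun q => dist z q = 1).card : ℝ) * (12 / ((23 : ℝ) - ((X.filter fun q => dist z q = 1).card : ℝ))) ≤ 10 / 3 := by
    rw [mul_div_assoc', div_le_div_iff₀ (by linarith) (by norm_num)]; linarith
  linarith

end DeficientReaders

namespace TailResidue

open scoped Classical in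
/-- **`MultiGrainSmall (2√6)` AT PAYERS OF DEGREE `≤ 3`** (regime (R-i), loose dust): the registered stub's conclusion, for every frame and
every window, with no off-site / mono-module hypothesis — a dust payer rattling against at most three balls never loads the joint row above
`13/3`. -/
theorem multiGrainSmall_of_degree_le_three (L : EuclideanSpace ℝ (Fin 3) ≃ₗᵢ[ℝ] EuclideanSpace ℝ (Fin 3))
    (X : Finset (EuclideanSpace ℝ (Fin 3))) (hX : ∀ p ∈ X, ∀ q ∈ X, p ≠ q → 1 ≤ dist p q)
    (z : EuclideanSpace ℝ (Fin 3)) (hz : z ∈ X) (hdeg : (X.filter fun q => dist z q = 1).card ≤ 3) :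
    localSummandA WordVersion.v2 (basalSystem L)
        (basalSystem (((ℝ ∙ EuclideanSpace.single (2 : Fin 3) (1 : ℝ)).reflection).trans L)) X z ≤ 2 * Real.sqrt 6 :=
  localSummandA_le_two_sqrt_six_of_degree_le_three WordVersion.v2 hX (Finset.filter_subset _ _) (Finset.filter_subset _ _) hz hdeg


open scoped Classical in
/-- **`MultiGrainSmall (2√6)` AT PAYERS OF DEGREE `≤ 5` WHOSE LOADED CONTACTS HAVE ONLY DEFICIENT READERS** (regime (R-i), dust in junk): the
registered stub's conclusion whenever no loaded contact of the payer is read by a fully coordinated ball — the complementary case (a FULL reader,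
i.e. a perfect 13-ball crystallite next to a contact of the payer) is the jammed-dust-next-to-a-crystal regime of F-TAIL-g10 §9. -/
theorem multiGrainSmall_of_degree_le_five_of_readers_deficient (L : EuclideanSpace ℝ (Fin 3) ≃ₗᵢ[ℝ] EuclideanSpace ℝ (Fin 3))
    (X : Finset (EuclideanSpace ℝ (Fin 3))) (hX : ∀ p ∈ X, ∀ q ∈ X, p ≠ q → 1 ≤ dist p q)
    (z : EuclideanSpace ℝ (Fin 3)) (hz : z ∈ X) (hdeg : (X.filter fun q => dist z q = 1).card ≤ 5)
    (hR : ∀ b ∈ X, dist z b ≤ 1 → b ≠ z → ∀ q ∈ X,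
      IsEndPairA X WordVersion.v2 (basalSystem L)
        (basalSystem (((ℝ ∙ EuclideanSpace.single (2 : Fin 3) (1 : ℝ)).reflection).trans L)) b q →
      (X.filter fun y => dist q y = 1).card ≤ 11) :
    localSummandA WordVersion.v2 (basalSystem L)
        (basalSystem (((ℝ ∙ EuclideanSpace.single (2 : Fin 3) (1 : ℝ)).reflection).trans L)) X z ≤ 2 * Real.sqrt 6 :=
  localSummandA_le_two_sqrt_six_of_degree_le_five WordVersion.v2 hX (Finset.filter_subset _ _) (Finset.filter_subset _ _) hz hdeg hR

end TailResidue

end Summit.Ventures.Crystal3D.Theorems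

end
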